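import Summits.KontsevichZagierPeriods.KontsevichZagierPeriods.Theorems.RootDecompQuadraticDescentBlowupPairP1

/-!
# DARK census pair #3 `[□²,1/(1+2x+2y+y²)] ≡ [□²,1/(2+x²+2xy+y²)]` DECIDED in `KZ.relations` by rules 1+2 (route `RootDecompQuadraticDescent`, instance of crux stmt-KontsevichZagierPeriods-28994 / stmt-4280) · part 2/3

Cell `decomp-kz`, lens 6 (decomp-kz-lens-6 g8c): `pair3` — diagonal fold + blow-up over the open base (`KZ.of_sub_of_mem_relations_of_affine`) + u = v² (primed fibre map, proved in-file) + reflection + Möbius t/(2−t) (g7 prediction P2(β) in kernel form; value ½·log(3/4) + √2(arctan √2 − arctan(1/√2))); packaged `blowupPair_descentTwoQ_instance` and `blowupPair_of_kzDimTwo` BY NAME; imports the LANDED `…DarkPairsEleven` reflection kit.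

Source: `HOME/decomp-kz-lens-6/g8/BlowupPair3.lean` sha256 f23bb012538601e3 (708 l; critic decomp-kz-crit-1 g2 CLEARED 2026-08-30T09:23:01Z, std axioms), split into 3 modules by the landing seat decomp-kz-census-1 g7 (contexts re-opened per part; generic docstrings added where the source had none; the route file is imported only by the last part, which proves the `KZDimTwo` corollaries BY NAME).  No `sorry`; standard axioms.  References: [cite: KontsevichZagier2001, §1.2].
-/

noncomputable section

open MeasureTheory Set MvPolynomial

namespace Summit.KontsevichZagierPeriods.RootDecompQuadraticDescent.BlowupPair

-- PRIVATE copy (landed twin lives in a farm-unbuilt module; dedup.landed): snoc2_zero, snoc2_one, init2_zero, last_one_eq, update_zero_apply_one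
/-- `snoc2_zero`: auxiliary theorem of the lens-6 development «blowup» (instances of 28994/4280) — see the module docstring; verbatim from the lens file. -/
@[simp] private theorem snoc2_zero (x : Fin 1 → ℝ) (t : ℝ) : (Fin.snoc x t : Fin 2 → ℝ) 0 = x 0 := rfl

/-- `snoc2_one`: auxiliary theorem of the lens-6 development «blowup» (instances of 28994/4280) — see the module docstring; verbatim from the lens file. -/
@[simp] private theorem snoc2_one (x : Fin 1 → ℝ) (t : ℝ) : (Fin.snoc x t : Fin 2 → ℝ) 1 = t := rfl

/-- `init2_zero`: auxiliary theorem of the lens-6 development «blowup» (instances of 28994/4280) — see the module docstring; verbatim from the lens file. -/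
@[simp] private theorem init2_zero (z : Fin 2 → ℝ) : Fin.init z 0 = z 0 := rfl

/-- `last_one_eq`: auxiliary theorem of the lens-6 development «blowup» (instances of 28994/4280) — see the module docstring; verbatim from the lens file. -/
private theorem last_one_eq : (Fin.last 1 : Fin 2) = 1 := rfl

/-- `update_zero_apply_one`: auxiliary theorem of the lens-6 development «blowup» (instances of 28994/4280) — see the module docstring; verbatim from the lens file. -/
@[simp] private theorem update_zero_apply_one (x : Fin 2 → ℝ) (a : ℝ) : Function.update x 0 a 1 = x 1 :=
  Function.update_of_ne (by decide) a x

open Literature.NumberTheory.Transcendental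
open Literature.NumberTheory.Transcendental.KZ
open Literature.ModelTheory.ExponentialFields (IsSemialgebraic)
open Summit.KontsevichZagierPeriods.RootDecompQuadraticDescent.DarkPairs (rel_reflect_rep rel_double
  update_one_apply_zero)

/-- The open base interval `{0 < u < 1}`. -/
def Gopen : Set (Fin 1 → ℝ) := {y | 0 < y 0 ∧ y 0 < 1}

/-- `isOpen_Gopen`: auxiliary theorem of the lens-6 development «blowup» (instances of 28994/4280) — see the module docstring; verbatim from the lens file. -/
theorem isOpen_Gopen : IsOpen Gopen :=
  (isOpen_lt continuous_const (continuous_apply 0)).inter (isOpen_lt (continuous_apply 0) continuous_const)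

/-- `isSemialgebraic_Gopen`: auxiliary theorem of the lens-6 development «blowup» (instances of 28994/4280) — see the module docstring; verbatim from the lens file. -/
theorem isSemialgebraic_Gopen : IsSemialgebraic ℚ Gopen := by
  have h1 := Literature.ModelTheory.ExponentialFields.isSemialgebraic_setOf_eval_lt (k := ℚ) (R := ℝ)
    (C 0 : MvPolynomial (Fin 1) ℚ) (X 0)
  have h2 := Literature.ModelTheory.ExponentialFields.isSemialgebraic_setOf_eval_lt (k := ℚ) (R := ℝ)
    (X 0 : MvPolynomial (Fin 1) ℚ) (C 1)
  simp only [aeval_X, aeval_C, eq_ratCast, Rat.cast_zero, Rat.cast_one] at h1 h2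
  exact h1.inter h2

/-- `isSemialgebraicFunOn_coord0`: auxiliary theorem of the lens-6 development «blowup» (instances of 28994/4280) — see the module docstring; verbatim from the lens file. -/
theorem isSemialgebraicFunOn_coord0 {G : Set (Fin 1 → ℝ)} (hG : IsSemialgebraic ℚ G) :
    IsSemialgebraicFunOn ℚ G fun y : Fin 1 → ℝ => y 0 :=
  (isSemialgebraicFunOn_aeval hG (X 0)).congr fun y _ => by simp

/-- `isSemialgebraicFunOn_zero'`: auxiliary theorem of the lens-6 development «blowup» (instances of 28994/4280) — see the module docstring; verbatim from the lens file. -/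
theorem isSemialgebraicFunOn_zero' {G : Set (Fin 1 → ℝ)} (hG : IsSemialgebraic ℚ G) :
    IsSemialgebraicFunOn ℚ G fun _ : Fin 1 → ℝ => (0 : ℝ) := by
  simpa using isSemialgebraicFunOn_ratCast hG 0

/-- `isSemialgebraicFunOn_one'`: auxiliary theorem of the lens-6 development «blowup» (instances of 28994/4280) — see the module docstring; verbatim from the lens file. -/
theorem isSemialgebraicFunOn_one' {G : Set (Fin 1 → ℝ)} (hG : IsSemialgebraic ℚ G) :
    IsSemialgebraicFunOn ℚ G fun _ : Fin 1 → ℝ => (1 : ℝ) := by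
  simpa using isSemialgebraicFunOn_ratCast hG 1

/-- The triangle minus its vertical edges, as a band: `Δ° = {0 < u < 1, 0 ≤ y ≤ u}`. -/
def Δo : Set (Fin 2 → ℝ) := KZlog.band Gopen (fun _ => 0) fun y => y 0
/-- The square minus two edges, as a band: `S° = {0 < u < 1, 0 ≤ k ≤ 1}`. -/
def So : Set (Fin 2 → ℝ) := KZlog.band Gopen (fun _ => 0) fun _ => 1

/-- `isSemialgebraic_Δo`: auxiliary theorem of the lens-6 development «blowup» (instances of 28994/4280) — see the module docstring; verbatim from the lens file. -/
theorem isSemialgebraic_Δo : IsSemialgebraic ℚ Δo :=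
  KZlog.isSemialgebraic_band (isSemialgebraicFunOn_zero' isSemialgebraic_Gopen)
    (isSemialgebraicFunOn_coord0 isSemialgebraic_Gopen)

/-- `isSemialgebraic_So`: auxiliary theorem of the lens-6 development «blowup» (instances of 28994/4280) — see the module docstring; verbatim from the lens file. -/
theorem isSemialgebraic_So : IsSemialgebraic ℚ So :=
  KZlog.isSemialgebraic_band (isSemialgebraicFunOn_zero' isSemialgebraic_Gopen)
    (isSemialgebraicFunOn_one' isSemialgebraic_Gopen)

/-- `mem_Δo`: auxiliary theorem of the lens-6 development «blowup» (instances of 28994/4280) — see the module docstring; verbatim from the lens file. -/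
theorem mem_Δo {z : Fin 2 → ℝ} : z ∈ Δo ↔ (0 < z 0 ∧ z 0 < 1) ∧ 0 ≤ z 1 ∧ z 1 ≤ z 0 := by
  rw [Δo, KZlog.mem_band, last_one_eq]; rfl

/-- `mem_So`: auxiliary theorem of the lens-6 development «blowup» (instances of 28994/4280) — see the module docstring; verbatim from the lens file. -/
theorem mem_So {z : Fin 2 → ℝ} : z ∈ So ↔ (0 < z 0 ∧ z 0 < 1) ∧ 0 ≤ z 1 ∧ z 1 ≤ 1 := by
  rw [So, KZlog.mem_band, last_one_eq]; rfl

/-- `Δo_subset`: auxiliary theorem of the lens-6 development «blowup» (instances of 28994/4280) — see the module docstring; verbatim from the lens file. -/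
theorem Δo_subset : Δo ⊆ Δ₁ := fun z hz => by
  rw [mem_Δo] at hz
  refine ⟨fun i => ?_, hz.2.2⟩
  fin_cases i
  · exact ⟨hz.1.1.le, hz.1.2.le⟩
  · exact ⟨hz.2.1, hz.2.2.trans hz.1.2.le⟩

/-- `So_subset`: auxiliary theorem of the lens-6 development «blowup» (instances of 28994/4280) — see the module docstring; verbatim from the lens file. -/
theorem So_subset : So ⊆ cube 2 := fun z hz => by
  rw [mem_So] at hz
  intro i
  fin_cases i
  · exact ⟨hz.1.1.le, hz.1.2.le⟩
  · exact ⟨hz.2.1, hz.2.2⟩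

/-- The two vertical edges `{u = 0} ∪ {u = 1}` are Lebesgue-null. -/
theorem volume_edges : volume ({z : Fin 2 → ℝ | z 0 = 0} ∪ {z | z 0 = 1}) = 0 := by
  have h0 := KZ.volume_setOf_init_mem_eq_zero (n := 1) (KZ.volume_setOf_last_eq_zero (n := 0) (0 : ℝ))
  have h1 := KZ.volume_setOf_init_mem_eq_zero (n := 1) (KZ.volume_setOf_last_eq_zero (n := 0) (1 : ℝ))
  exact measure_union_null (measure_mono_null (fun z hz => hz) h0) (measure_mono_null (fun z hz => hz) h1)

/-- `volume_Δ₁_diff_Δo`: auxiliary theorem of the lens-6 development «blowup» (instances of 28994/4280) — see the module docstring; verbatim from the lens file. -/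
theorem volume_Δ₁_diff_Δo : volume (Δ₁ \ Δo) = 0 := by
  refine measure_mono_null (fun z hz => ?_) volume_edges
  obtain ⟨⟨hc, hle⟩, h2⟩ := hz
  rw [mem_Δo] at h2
  have h0 := hc 0
  have h1 := hc 1
  by_contra hne
  simp only [mem_union, mem_setOf_eq, not_or] at hne
  exact h2 ⟨⟨lt_of_le_of_ne h0.1 (Ne.symm hne.1), lt_of_le_of_ne h0.2 hne.2⟩, h1.1, hle⟩

/-- `volume_cube_diff_So`: auxiliary theorem of the lens-6 development «blowup» (instances of 28994/4280) — see the module docstring; verbatim from the lens file. -/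
theorem volume_cube_diff_So : volume (cube 2 \ So) = 0 := by
  refine measure_mono_null (fun z hz => ?_) volume_edges
  obtain ⟨hc, h2⟩ := hz
  rw [mem_So] at h2
  have h0 := hc 0
  have h1 := hc 1
  by_contra hne
  simp only [mem_union, mem_setOf_eq, not_or] at hne
  exact h2 ⟨⟨lt_of_le_of_ne h0.1 (Ne.symm hne.1), lt_of_le_of_ne h0.2 hne.2⟩, h1.1, h1.2⟩

/-! ## §4 The data of census pair #3 and of the intermediate representations -/

/-- `1 + 2x + 2y + y² = (1+y)² + 2x` (census #3, first member) and `2 + x² + 2xy + y² = 2 + (x+y)²`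
(second member); `2 + u²(1+k)²` (blow-up), `2 + v²(1+t)²` (relabelled), `2 + u(1+t)²` (after `u = v²`),
`2 + x(1+y)²` (relabelled), `2 + x(2−y)²` (reflected). -/
def QA3 : MvPolynomial (Fin 2) ℚ := 1 + 2 * X 0 + 2 * X 1 + X 1 ^ 2
/-- `QB3`: auxiliary def of the lens-6 development «blowup» (instances of 28994/4280) — see the module docstring; verbatim from the lens file. -/
def QB3 : MvPolynomial (Fin 2) ℚ := 2 + X 0 ^ 2 + 2 * X 0 * X 1 + X 1 ^ 2
/-- `Qbl`: auxiliary def of the lens-6 development «blowup» (instances of 28994/4280) — see the module docstring; verbatim from the lens file. -/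
def Qbl : MvPolynomial (Fin 2) ℚ := 2 + X 0 ^ 2 * (1 + X 1) ^ 2
/-- `Qbs`: auxiliary def of the lens-6 development «blowup» (instances of 28994/4280) — see the module docstring; verbatim from the lens file. -/
def Qbs : MvPolynomial (Fin 2) ℚ := 2 + X 1 ^ 2 * (1 + X 0) ^ 2
/-- `QB1`: auxiliary def of the lens-6 development «blowup» (instances of 28994/4280) — see the module docstring; verbatim from the lens file. -/
def QB1 : MvPolynomial (Fin 2) ℚ := 2 + X 1 * (1 + X 0) ^ 2
/-- `QB1r`: auxiliary def of the lens-6 development «blowup» (instances of 28994/4280) — see the module docstring; verbatim from the lens file. -/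
def QB1r : MvPolynomial (Fin 2) ℚ := 2 + X 0 * (1 + X 1) ^ 2
/-- `QB2`: auxiliary def of the lens-6 development «blowup» (instances of 28994/4280) — see the module docstring; verbatim from the lens file. -/
def QB2 : MvPolynomial (Fin 2) ℚ := 2 + X 0 * (2 - X 1) ^ 2

/-- `QA3_pos`: auxiliary theorem of the lens-6 development «blowup» (instances of 28994/4280) — see the module docstring; verbatim from the lens file. -/
theorem QA3_pos {x : Fin 2 → ℝ} (hx : x ∈ cube 2) : 0 < aeval x QA3 := by
  have h0 := hx 0; have h1 := hx 1
  simp only [QA3, map_add, map_mul, map_pow, map_ofNat, map_one, aeval_X]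
  nlinarith [h0.1, h1.1, sq_nonneg (x 1)]
/-- `QB3_pos`: auxiliary theorem of the lens-6 development «blowup» (instances of 28994/4280) — see the module docstring; verbatim from the lens file. -/
theorem QB3_pos {x : Fin 2 → ℝ} (_hx : x ∈ cube 2) : 0 < aeval x QB3 := by
  simp only [QB3, map_add, map_mul, map_pow, map_ofNat, aeval_X]
  nlinarith [sq_nonneg (x 0 + x 1)]
/-- `Qbl_pos`: auxiliary theorem of the lens-6 development «blowup» (instances of 28994/4280) — see the module docstring; verbatim from the lens file. -/
theorem Qbl_pos {x : Fin 2 → ℝ} (_hx : x ∈ cube 2) : 0 < aeval x Qbl := by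
  simp only [Qbl, map_add, map_mul, map_pow, map_ofNat, map_one, aeval_X]
  positivity
/-- `Qbs_pos`: auxiliary theorem of the lens-6 development «blowup» (instances of 28994/4280) — see the module docstring; verbatim from the lens file. -/
theorem Qbs_pos {x : Fin 2 → ℝ} (_hx : x ∈ cube 2) : 0 < aeval x Qbs := by
  simp only [Qbs, map_add, map_mul, map_pow, map_ofNat, map_one, aeval_X]
  positivity
/-- `QB1_pos`: auxiliary theorem of the lens-6 development «blowup» (instances of 28994/4280) — see the module docstring; verbatim from the lens file. -/
theorem QB1_pos {x : Fin 2 → ℝ} (hx : x ∈ cube 2) : 0 < aeval x QB1 := by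
  have h1 := hx 1
  simp only [QB1, map_add, map_mul, map_pow, map_ofNat, map_one, aeval_X]
  nlinarith [mul_nonneg h1.1 (sq_nonneg (1 + x 0))]
/-- `QB1r_pos`: auxiliary theorem of the lens-6 development «blowup» (instances of 28994/4280) — see the module docstring; verbatim from the lens file. -/
theorem QB1r_pos {x : Fin 2 → ℝ} (hx : x ∈ cube 2) : 0 < aeval x QB1r := by
  have h0 := hx 0
  simp only [QB1r, map_add, map_mul, map_pow, map_ofNat, map_one, aeval_X]
  nlinarith [mul_nonneg h0.1 (sq_nonneg (1 + x 1))]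
/-- `QB2_pos`: auxiliary theorem of the lens-6 development «blowup» (instances of 28994/4280) — see the module docstring; verbatim from the lens file. -/
theorem QB2_pos {x : Fin 2 → ℝ} (hx : x ∈ cube 2) : 0 < aeval x QB2 := by
  have h0 := hx 0
  simp only [QB2, map_add, map_sub, map_mul, map_pow, map_ofNat, aeval_X]
  nlinarith [mul_nonneg h0.1 (sq_nonneg (2 - x 1))]

/-- `A3 = [□²,1/(1+2x+2y+y²)]`, `B3 = [□²,1/(2+x²+2xy+y²)]`, `Tb = [□²,u/(2+u²(1+k)²)]`,
`Tbs = [□²,v/(2+v²(1+t)²)]`, `Cd = [□²,2v/(2+v²(1+t)²)]`, `B1 = [□²,1/(2+u(1+t)²)]`,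
`B1r = [□²,1/(2+x(1+y)²)]`, `B2 = [□²,1/(2+x(2−y)²)]`. -/
def A3 : RFun 2 := ⟨1, QA3, fun _ hx => (QA3_pos hx).ne'⟩
/-- `B3`: auxiliary def of the lens-6 development «blowup» (instances of 28994/4280) — see the module docstring; verbatim from the lens file. -/
def B3 : RFun 2 := ⟨1, QB3, fun _ hx => (QB3_pos hx).ne'⟩
/-- `Tb`: auxiliary def of the lens-6 development «blowup» (instances of 28994/4280) — see the module docstring; verbatim from the lens file. -/
def Tb : RFun 2 := ⟨X 0, Qbl, fun _ hx => (Qbl_pos hx).ne'⟩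
/-- `Tbs`: auxiliary def of the lens-6 development «blowup» (instances of 28994/4280) — see the module docstring; verbatim from the lens file. -/
def Tbs : RFun 2 := ⟨X 1, Qbs, fun _ hx => (Qbs_pos hx).ne'⟩
/-- `Cd`: auxiliary def of the lens-6 development «blowup» (instances of 28994/4280) — see the module docstring; verbatim from the lens file. -/
def Cd : RFun 2 := ⟨2 * X 1, Qbs, fun _ hx => (Qbs_pos hx).ne'⟩
/-- `B1`: auxiliary def of the lens-6 development «blowup» (instances of 28994/4280) — see the module docstring; verbatim from the lens file. -/
def B1 : RFun 2 := ⟨1, QB1, fun _ hx => (QB1_pos hx).ne'⟩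
/-- `B1r`: auxiliary def of the lens-6 development «blowup» (instances of 28994/4280) — see the module docstring; verbatim from the lens file. -/
def B1r : RFun 2 := ⟨1, QB1r, fun _ hx => (QB1r_pos hx).ne'⟩
/-- `B2`: auxiliary def of the lens-6 development «blowup» (instances of 28994/4280) — see the module docstring; verbatim from the lens file. -/
def B2 : RFun 2 := ⟨1, QB2, fun _ hx => (QB2_pos hx).ne'⟩

/-- `rel_trans`: auxiliary theorem of the lens-6 development «blowup» (instances of 28994/4280) — see the module docstring; verbatim from the lens file. -/
theorem rel_trans {x y z : KZ.FormalRep} (h₁ : x - y ∈ KZ.relations) (h₂ : y - z ∈ KZ.relations) :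
    x - z ∈ KZ.relations := by
  have h := add_mem h₁ h₂
  rwa [sub_add_sub_cancel] at h

/-- `rel_symm`: auxiliary theorem of the lens-6 development «blowup» (instances of 28994/4280) — see the module docstring; verbatim from the lens file. -/
theorem rel_symm {x y : KZ.FormalRep} (h : x - y ∈ KZ.relations) : y - x ∈ KZ.relations := by
  have h' := neg_mem h
  rwa [neg_sub] at h'

/-! ## §5 The chain -/

/-- `B3` is symmetric under `x ↔ y`. -/
theorem B3_swap (z : Fin 2 → ℝ) : B3.fn z = B3.fn (z ∘ Equiv.swap 0 1) := by
  simp only [RFun.fn, B3, QB3, map_add, map_mul, map_pow, map_ofNat, map_one, aeval_X,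
    Function.comp_apply, Equiv.swap_apply_left, Equiv.swap_apply_right]
  ring

/-- (1) Cut along the diagonal and fold by the symmetry: `B ≡ 2·[Δ₁, B]` (rules 1a + 2). -/
theorem c1 : KZ.of B3.rep - 2 • KZ.of (rLow B3) ∈ KZ.relations := rel_fold_diag B3 B3_swap

/-- `[Δ°, B]` and `[S°, u/(2+u²(1+k)²)]`. -/
def rLowo : IntegralRep 2 := B3.rep.restrict Δo isSemialgebraic_Δo fun _ hz => (Δo_subset hz).1
/-- `rSo`: auxiliary def of the lens-6 development «blowup» (instances of 28994/4280) — see the module docstring; verbatim from the lens file. -/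
def rSo : IntegralRep 2 := Tb.rep.restrict So isSemialgebraic_So fun _ hz => So_subset hz

/-- (2) Null move: `[Δ₁, B] ≡ [Δ°, B]`. -/
theorem c2 : KZ.of (rLow B3) - KZ.of rLowo ∈ KZ.relations :=
  of_sub_of_mem_relations_of_null _ _ volume_Δ₁_diff_Δo
    (by rw [show rLowo.domain \ (rLow B3).domain = ∅ from sdiff_eq_empty.mpr Δo_subset]
        exact measure_empty)
    fun _ _ => rfl

/-- (3) The blow-up `(u, k) ↦ (u, u·k)` of the corner: `[S°, u/(2+u²(1+k)²)] ≡ [Δ°, B]`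
(affine fibre substitution over the open base `0 < u < 1`, Jacobian `u`). -/
theorem c3 : KZ.of rSo - KZ.of rLowo ∈ KZ.relations := by
  refine of_sub_of_mem_relations_of_affine isOpen_Gopen (α := fun _ => 0) (β := fun y => y 0)
    (a := fun _ => 0) (b := fun _ => 1) (a' := fun _ => 0) (b' := fun y => y 0)
    (isSemialgebraicFunOn_zero' isSemialgebraic_Gopen) (isSemialgebraicFunOn_coord0 isSemialgebraic_Gopen)
    (differentiableOn_const _)
    (fun y _ => (hasFDerivAt_apply (𝕜 := ℝ) (0 : Fin 1) y).differentiableAt.differentiableWithinAt)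
    (fun y hy => hy.1) rSo rLowo rfl rfl (fun y _ => by simp) (fun y _ => by simp) fun z hz => ?_
  show Tb.fn z = B3.fn (Fin.snoc (Fin.init z) (0 + Fin.init z 0 * z (Fin.last 1))) * Fin.init z 0
  rw [last_one_eq]
  simp only [RFun.fn, Tb, B3, Qbl, QB3, map_add, map_mul, map_pow, map_ofNat, map_one,
    aeval_X, snoc2_zero, snoc2_one, init2_zero, zero_add]
  ring

/-- (4) Null move: `[□², u/(2+u²(1+k)²)] ≡ [S°, u/(2+u²(1+k)²)]`. -/
theorem c4 : KZ.of Tb.rep - KZ.of rSo ∈ KZ.relations :=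
  IntegralRep.of_sub_of_restrict_mem_relations _ isSemialgebraic_So So_subset volume_cube_diff_So

/-- `B ≡ 2·[□², u/(2+u²(1+k)²)]`. -/
theorem B3_Tb : KZ.of B3.rep - 2 • KZ.of Tb.rep ∈ KZ.relations := by
  have h := sub_mem (sub_mem (add_mem c1 (KZ.relations.nsmul_mem c2 2))
    (KZ.relations.nsmul_mem c3 2)) (KZ.relations.nsmul_mem c4 2)
  convert h using 1
  module

/-- (5) Relabelling `u ↔ k`: `Tb ≡ Tbs = [□², v/(2+v²(1+t)²)]`. -/
theorem c5 : KZ.of Tb.rep - KZ.of Tbs.rep ∈ KZ.relations := by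
  have h1 := RFun.rel_rename Tb (Equiv.swap 0 1)
  have h2 : KZ.of (Tb.rename (Equiv.swap 0 1)).rep - KZ.of Tbs.rep ∈ KZ.relations :=
    RFun.rel_of_eqOn fun z _ => by
      rw [RFun.fn_rename]
      simp only [RFun.fn, Tb, Tbs, Qbl, Qbs, map_add, map_mul, map_pow, map_ofNat, map_one, aeval_X,
        Function.comp_apply, Equiv.swap_apply_left, Equiv.swap_apply_right]
  exact rel_trans h1 h2

/-- (6) Doubling the integrand (rule 1b): `Cd = [□², 2v/(2+v²(1+t)²)] ≡ 2·Tbs`. -/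
theorem c6 : KZ.of Cd.rep - 2 • KZ.of Tbs.rep ∈ KZ.relations :=
  rel_double Tbs Cd fun z _ => by
    simp only [RFun.fn, Tbs, Cd, map_mul, map_ofNat, aeval_X]
    ring

/-- (7) The substitution `u = v²` in the last coordinate (Jacobian `2v`, vanishing on the edge
`v = 0` only): `Cd ≡ B1 = [□², 1/(2+u(1+t)²)]`. -/
theorem c7 : KZ.of Cd.rep - KZ.of B1.rep ∈ KZ.relations := by
  refine of_sub_of_mem_relations_of_fibreMap' (G := ivl 0 1) (a := fun _ => 0) (b := fun _ => 1)
    (a' := fun _ => 0) (b' := fun _ => 1) (fun z => z 1 ^ 2) (fun z => 2 * z 1)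
    Cd.rep B1.rep cube_eq_band cube_eq_band (fun _ _ => zero_le_one) ?_ ?_ ?_ ?_ ?_ ?_ ?_ ?_
  · exact (isSemialgebraicFunOn_aeval isSemialgebraic_cube (X 1 ^ 2 : MvPolynomial (Fin 2) ℚ)).congr
      fun z _ => by simp
  · intro z _
    fun_prop
  · intro z _
    show HasDerivAt (fun t => (Fin.snoc (Fin.init z) t : Fin 2 → ℝ) 1 ^ 2) _ (z 1)
    simp only [snoc2_one]
    simpa using hasDerivAt_pow 2 (z 1)
  · intro z _ h0 _
    have h0' : (0 : ℝ) < z 1 := by simpa [last_one_eq] using h0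
    linarith
  · intro z hz
    have h1 := (hz 1).1
    linarith
  · intro y _
    simp
  · intro y _
    simp
  · intro z _
    rw [RFun.rep_integrand, RFun.rep_integrand]
    simp only [RFun.fn, Cd, B1, Qbs, QB1, map_add, map_mul, map_pow, map_ofNat, map_one, aeval_X,
      snoc2_zero, snoc2_one, init2_zero]
    ring

/-- (8) Relabelling `t ↔ u`: `B1 ≡ B1r = [□², 1/(2+x(1+y)²)]`. -/
theorem c8 : KZ.of B1.rep - KZ.of B1r.rep ∈ KZ.relations := by
  have h1 := RFun.rel_rename B1 (Equiv.swap 0 1)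
  have h2 : KZ.of (B1.rename (Equiv.swap 0 1)).rep - KZ.of B1r.rep ∈ KZ.relations :=
    RFun.rel_of_eqOn fun z _ => by
      rw [RFun.fn_rename]
      simp only [RFun.fn, B1, B1r, QB1, QB1r, map_add, map_mul, map_pow, map_ofNat, map_one, aeval_X,
        Function.comp_apply, Equiv.swap_apply_left, Equiv.swap_apply_right]
  exact rel_trans h1 h2

/-- (9) Reflection `y ↦ 1 − y`: `B2 = [□², 1/(2+x(2−y)²)] ≡ B1r`. -/
theorem c9 : KZ.of B2.rep - KZ.of B1r.rep ∈ KZ.relations := by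
  refine rel_reflect_rep 2 1 B2.rep B1r.rep B2.isTameCube_rep B1r.isTameCube_rep fun x _ => ?_
  rw [RFun.rep_integrand, RFun.rep_integrand]
  simp only [RFun.fn, B2, B1r, QB2, QB1r, map_add, map_sub, map_mul, map_pow, map_ofNat, map_one,
    aeval_X, Function.update_self, update_one_apply_zero]
  ring

end Summit.KontsevichZagierPeriods.RootDecompQuadraticDescent.BlowupPair

end
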